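import Mathlib
import Summits.ValiantsHypothesis.ValiantsHypothesis.Theorems.TriangularDimersDivisionEasy.Negative.Basic

/-!
# `TriangularDimersDivisionEasy` — negative-side toolkit 6a: isoperimetry — rows, mixed rows, counting

Crux `stmt-ValiantsHypothesis-5067` (`Theses.DivisionGap.TriangularDimersDivisionEasy`, route
DivisionGap).  Standing disprover (cdisprove gen 1); step V3 of the load-bearing lemma
`false_without_division` (Valiant 1980, Thm 1, for the rhombus; cf. his Lemmas 6–7).

Rows of `R_n` read on natural coordinates (`memN`), inner indices, horizontally mixed rows
(`MixedRow`, `const_of_not_mixed`), and the counting lemma `exists_full_row`: if few inner rows are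
mixed and `n² ≤ 3|B|`, some inner row is inner-full for `B`.  Used by `Gadgets.lean`
(`exists_gadgets`).
[folklore]
-/

namespace Summit.ValiantsHypothesis.ValiantsHypothesis.Theorems.TriangularDimersDivisionEasy.Negative

open scoped BigOperators

set_option linter.dupNamespace false

noncomputable section

open Classical

variable {n : ℕ}

/-! ## Rows, inner indices, mixed rows -/

/-- Membership read on natural coordinates (false outside the rhombus). [folklore] -/
def memN (B : Finset (Vtx n)) (i j : ℕ) : Prop := ∃ (hi : i < n) (hj : j < n), ((⟨i, hi⟩, ⟨j, hj⟩) : Vtx n) ∈ B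

/-- `memN` on coordinates inside the rhombus is membership. [folklore] -/
theorem memN_iff {B : Finset (Vtx n)} {i j : ℕ} (hi : i < n) (hj : j < n) :
    memN B i j ↔ ((⟨i, hi⟩, ⟨j, hj⟩) : Vtx n) ∈ B := by
  constructor
  · rintro ⟨_, _, h⟩; exact h
  · intro h; exact ⟨hi, hj, h⟩

/-- `memN` only holds inside the rhombus. [folklore] -/
theorem memN_lt {B : Finset (Vtx n)} {i j : ℕ} (h : memN B i j) : i < n ∧ j < n := by
  obtain ⟨hi, hj, _⟩ := h; exact ⟨hi, hj⟩

/-- Inner indices: `3 ≤ k` and `k + 4 ≤ n` (a gadget centred there, in either orientation, fits on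
this axis). [folklore] -/
def Inner (n k : ℕ) : Prop := 3 ≤ k ∧ k + 4 ≤ n

/-- Row `i` has a horizontal mixed edge `(i,j)–(i,j+1)` with `j`, `j+1` inner. [folklore] -/
def MixedRow (B : Finset (Vtx n)) (i : ℕ) : Prop :=
  ∃ j, 3 ≤ j ∧ j + 5 ≤ n ∧ ¬ (memN B i j ↔ memN B i (j + 1))

/-- A non-mixed row is constant on the inner columns. [folklore] -/
theorem const_of_not_mixed {B : Finset (Vtx n)} {i : ℕ} (h : ¬ MixedRow B i) :
    ∀ j j', 3 ≤ j → j ≤ j' → j' + 4 ≤ n → (memN B i j ↔ memN B i j') := by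
  intro j j' hj hjj' hj'
  induction j', hjj' using Nat.le_induction with
  | base => exact Iff.rfl
  | succ k hk ih =>
    have h1 := ih (by omega)
    have h2 : memN B i k ↔ memN B i (k + 1) := by
      by_contra hne
      exact h ⟨k, by omega, by omega, hne⟩
    exact h1.trans h2

/-! ## Counting: few mixed rows force an inner-full row -/

/-- The row of `i`. [folklore] -/
def rowOf (B : Finset (Vtx n)) (i : Fin n) : Finset (Vtx n) := B.filter fun x => x.1 = i

/-- The size of a vertex set is the sum of its row sizes. [folklore] -/
theorem card_eq_sum_rows (B : Finset (Vtx n)) : B.card = ∑ i : Fin n, (rowOf B i).card := by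
  unfold rowOf
  exact Finset.card_eq_sum_card_fiberwise (f := Prod.fst) (t := Finset.univ) (fun _ _ => Finset.mem_univ _)

/-- A row has at most `n` elements. [folklore] -/
theorem card_rowOf_le (B : Finset (Vtx n)) (i : Fin n) : (rowOf B i).card ≤ n := by
  calc (rowOf B i).card ≤ (Finset.univ.image fun j : Fin n => ((i, j) : Vtx n)).card := by
        apply Finset.card_le_card
        intro x hx
        rw [rowOf, Finset.mem_filter] at hx
        rw [Finset.mem_image]
        exact ⟨x.2, Finset.mem_univ _, by rw [← hx.2]⟩
    _ ≤ (Finset.univ : Finset (Fin n)).card := Finset.card_image_le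
    _ = n := by simp

/-- An inner-empty row has at most `6` elements (in the non-inner columns). [folklore] -/
theorem card_rowOf_le_six {B : Finset (Vtx n)} {i : Fin n}
    (hempty : ∀ j, Inner n j → ¬ memN B i j) : (rowOf B i).card ≤ 6 := by
  -- the row injects, by the column index, into the ≤ 6 non-inner column indices
  have hsub : ∀ x ∈ rowOf B i, (x.2 : ℕ) ∈ (Finset.range 3 ∪ Finset.Ico (n - 3) n) := by
    intro x hx
    rw [rowOf, Finset.mem_filter] at hx
    have hxB : memN B i x.2 := by
      refine ⟨i.2, x.2.2, ?_⟩
      have : ((⟨(i : ℕ), i.2⟩, ⟨(x.2 : ℕ), x.2.2⟩) : Vtx n) = x := by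
        rw [← hx.2]
      rw [this]; exact hx.1
    by_contra hni
    simp only [Finset.mem_union, Finset.mem_range, Finset.mem_Ico, not_or, not_lt, not_and] at hni
    apply hempty x.2 ⟨hni.1, ?_⟩ hxB
    have := x.2.2
    omega
  calc (rowOf B i).card ≤ (Finset.range 3 ∪ Finset.Ico (n - 3) n).card :=
        Finset.card_le_card_of_injOn (fun x => (x.2 : ℕ)) hsub (by
          intro x hx y hy hxy
          rw [Finset.mem_coe, rowOf, Finset.mem_filter] at hx hy
          exact Prod.ext (hx.2.trans hy.2.symm) (Fin.ext hxy))
    _ ≤ (Finset.range 3).card + (Finset.Ico (n - 3) n).card := Finset.card_union_le _ _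
    _ ≤ 6 := by simp; omega

/-- At most `6` row indices are non-inner. [folklore] -/
theorem card_nonInner_le : (Finset.univ.filter fun i : Fin n => ¬ Inner n i).card ≤ 6 := by
  have hsub : ∀ i ∈ (Finset.univ.filter fun i : Fin n => ¬ Inner n i),
      (i : ℕ) ∈ (Finset.range 3 ∪ Finset.Ico (n - 3) n) := by
    intro i hi
    rw [Finset.mem_filter] at hi
    simp only [Inner, not_and, not_le] at hi
    simp only [Finset.mem_union, Finset.mem_range, Finset.mem_Ico]
    have := i.2
    by_cases h3 : (i : ℕ) < 3
    · exact Or.inl h3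
    · right; constructor <;> omega
  calc (Finset.univ.filter fun i : Fin n => ¬ Inner n i).card ≤ (Finset.range 3 ∪ Finset.Ico (n - 3) n).card :=
        Finset.card_le_card_of_injOn (fun i => (i : ℕ)) hsub (by
          intro x _ y _ hxy; exact Fin.ext hxy)
    _ ≤ (Finset.range 3).card + (Finset.Ico (n - 3) n).card := Finset.card_union_le _ _
    _ ≤ 6 := by simp; omega

/-- **Few mixed rows force an inner-full row.**  If `M` contains every mixed inner row, `3|M| + 37 ≤ n`
and `n² ≤ 3|B|`, some inner row outside `M` is inner-full for `B`. [folklore] -/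
theorem exists_full_row (B : Finset (Vtx n)) (M : Finset (Fin n))
    (hM : ∀ i : Fin n, Inner n i → MixedRow B i → i ∈ M) (hsmall : 3 * M.card + 37 ≤ n)
    (hB : n * n ≤ 3 * B.card) :
    ∃ i : Fin n, Inner n i ∧ i ∉ M ∧ ∀ j, Inner n j → memN B i j := by
  by_contra hno
  push Not at hno
  -- every inner row outside M is inner-empty
  have hempty : ∀ i : Fin n, Inner n i → i ∉ M → ∀ j, Inner n j → ¬ memN B i j := by
    intro i hin hiM j hj hmem
    obtain ⟨j', hj', hnot⟩ := hno i hin hiM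
    have hnm : ¬ MixedRow B i := fun hm => hiM (hM i hin hm)
    rcases le_total j j' with hle | hle
    · exact hnot ((const_of_not_mixed hnm j j' hj.1 hle hj'.2).1 hmem)
    · exact hnot ((const_of_not_mixed hnm j' j hj'.1 hle hj.2).2 hmem)
  -- bound each row
  set P : Finset (Fin n) := Finset.univ.filter fun i : Fin n => ¬ Inner n i ∨ i ∈ M with hP
  have hrow : ∀ i : Fin n, (rowOf B i).card ≤ if i ∈ P then n else 6 := by
    intro i
    split_ifs with hi
    · exact card_rowOf_le B i
    · rw [hP, Finset.mem_filter, not_and_or] at hi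
      simp only [Finset.mem_univ, not_true_eq_false, false_or, not_or, not_not] at hi
      exact card_rowOf_le_six (hempty i hi.1 hi.2)
  have hPcard : P.card ≤ 6 + M.card := by
    calc P.card ≤ ((Finset.univ.filter fun i : Fin n => ¬ Inner n i) ∪ M).card := by
          apply Finset.card_le_card
          intro i hi
          rw [hP, Finset.mem_filter] at hi
          rw [Finset.mem_union, Finset.mem_filter]
          rcases hi.2 with h | h
          · exact Or.inl ⟨Finset.mem_univ _, h⟩
          · exact Or.inr h
      _ ≤ _ := (Finset.card_union_le _ _).trans (Nat.add_le_add_right card_nonInner_le _)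
  have hsum : B.card ≤ P.card * n + 6 * n := by
    rw [card_eq_sum_rows]
    calc ∑ i : Fin n, (rowOf B i).card ≤ ∑ i : Fin n, (if i ∈ P then n else 6) := Finset.sum_le_sum fun i _ => hrow i
      _ = ∑ i ∈ Finset.univ.filter (fun i : Fin n => i ∈ P), n +
            ∑ i ∈ Finset.univ.filter (fun i : Fin n => ¬ i ∈ P), 6 := Finset.sum_ite _ _
      _ ≤ P.card * n + 6 * n := by
          rw [Finset.sum_const, Finset.sum_const, smul_eq_mul, smul_eq_mul]
          apply Nat.add_le_add
          · apply Nat.mul_le_mul_right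
            apply Finset.card_le_card
            intro i hi; exact (Finset.mem_filter.1 hi).2
          · rw [mul_comm]
            apply Nat.mul_le_mul_left
            calc _ ≤ (Finset.univ : Finset (Fin n)).card := Finset.card_le_card (Finset.filter_subset _ _)
              _ = n := by simp
  have : n * n ≤ 3 * ((6 + M.card) * n + 6 * n) := by
    calc n * n ≤ 3 * B.card := hB
      _ ≤ 3 * (P.card * n + 6 * n) := Nat.mul_le_mul_left _ hsum
      _ ≤ 3 * ((6 + M.card) * n + 6 * n) := by
          apply Nat.mul_le_mul_left; apply Nat.add_le_add_right; exact Nat.mul_le_mul_right _ hPcard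
  -- n * n ≤ (36 + 3|M|) * n contradicts 3|M| + 37 ≤ n
  have hn : 0 < n := by omega
  have : n ≤ 3 * (6 + M.card) + 18 := by
    by_contra hlt
    push Not at hlt
    have : 3 * ((6 + M.card) * n + 6 * n) < n * n := by nlinarith
    omega
  omega

end

end Summit.ValiantsHypothesis.ValiantsHypothesis.Theorems.TriangularDimersDivisionEasy.Negative
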